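import Summits.BirchSwinnertonDyer.BirchSwinnertonDyer.Theorems.UniversalToricDescentTwistedDualTransfer
import Summits.BirchSwinnertonDyer.BirchSwinnertonDyer.Theorems.UniversalToricDescentTwistedStrictLift
import Summits.BirchSwinnertonDyer.Rank1Residual.X11b.BDPRouteControlStrictPlace
import Summits.BirchSwinnertonDyer.Rank1Residual.X11b.CoinvariantsDescent
import Summits.BirchSwinnertonDyer.Rank1Residual.X11b.AnticyclotomicInfinitePlaces
import Literature.NumberTheory.EllipticCurves.ZpExtensionGaloisTwistExponentProofs
import HarnessLib

/-!
# Route UniversalToricDescent — Greenberg's twisted descent, DUAL-SIDE CONTROL for Castella's structure: a dual Selmer class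
# of the strict structure `𝓕_Q` on `E[p^J](χ_u)`, read in `E[p^J](χ_{u'})` through the twisted Weil duality, lands in
# `Sel_𝔭^{S₀}(K_∞, E[p^∞])` — the CONJUGATE Selmer group (strict at the prime `𝔭 ∉ Q` over `p`) — and is killed by a
# `J`-independent power of `p`

Lead prover bsd-wall-utd-p1 g14 (`--supports` ♭T′ stmt-BirchSwinnertonDyer-26975; line `sigmacongruence` v3, bricks for the twin stubs TS1/TS2).
Greenberg, LNM 1716 p. 123: the dual Selmer classes of the twisted Poitou–Tate problem live in `S_{M^*}(F_∞) = Sel ⊗ κ^{-s}` and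
«`S'_{T^*}(F)` … is finite … in `H¹(F_Σ/F, T^*)_tors`». For the strict structure `𝓕_Q` of `…TwistedStrictLift` (target places
`Q`, among them NOT the prime `𝔭`) over a TOTALLY COMPLEX `K`:

* §1 `twistedTorsionToH1_mem_awayKer_of_res_eq_zero` — `res_{K_v} y' = 0 ⟹ twistedTorsionToH1 y'` dies on `ker κ ⊓ D_v`
  (cocycle computation; the twist is invisible on `ker κ`);
* §2 `twistedTorsionToH1_mem_selmerAc_of_mem_dualSelmer_strict` — for `y = H¹(w) y' ∈ H¹_{𝓕_Q^*}(K, M_J^D)`: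
  `c_{y'} = twistedTorsionToH1 y' ∈ selmerAc E p κ 𝔭 S₀` (strict at `𝔭`: `𝓕_𝔭 = ⊤` so `loc_𝔭 y = 0`; away at the good places
  `v ∉ S₀`, `v ∤ p`: dual-unramified ⟹ unramified ⟹ locally trivial over `K_∞` — at the finitely decomposed ones by the
  tree's `unramKer_le_awayKer`, at the totally split ones by the hypothesis `hsplit` (= `H¹_ur(D_v, E[p^∞]) = 0` at good `v`,
  to be discharged in a sequel); no condition at `S₀`, at the other primes over `p`, at `∞`);
* §3 `pow_smul_eq_zero_of_mem_dualSelmer_strict` — hence `p^{a+b+b} · y' = 0` whenever `p^a` kills the `u`-eigenvectors of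
  `conj_γ` on `Sel_𝔭^{S₀}` (generic `u`: `…TwistedEigenFinite`) and `p^b` the `Gal(K̄/K_∞)`-fixed points of `E[p^∞]`
  (t42's `pow_smul_eq_zero_of_twistedTorsionToH1_mem`).

HONEST STATUS: helper theorems (plumbing; `hsplit` and the Weil-pairing data are hypotheses). THEOREMS ONLY; no definition, no named
fact, no `sorry`. BSD is not advanced by this file.
References: [GreenbergLNM1716] §4 pp. 123–125; [GreenbergVatsal2000] §2 pp. 16–17; [Castella2018] Def. 2.2; [MilneADT2006] I Thm. 2.6.
-/

set_option autoImplicit false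
-- `…BirchSwinnertonDyer.BirchSwinnertonDyer.Theorems…` is the problem's mandated namespace (D-0017).
set_option linter.dupNamespace false

noncomputable section
open scoped Classical

namespace Summit.BirchSwinnertonDyer.BirchSwinnertonDyer.Theorems.UniversalToricDescentTwistedDescent

open NumberField IsDedekindDomain Field WeierstrassCurve CategoryTheory
  Literature.NumberTheory.EllipticCurves Literature.NumberTheory.GaloisRepresentations Literature.NumberTheory.GaloisCohomology
  Literature.NumberTheory.EllipticCurves.GreenbergSelmer Literature.NumberTheory.EllipticCurves.GreenbergVatsal2000
  Summit.BirchSwinnertonDyer.Rank1Residual.X11b Summit.BirchSwinnertonDyer.Rank1Residual.X11b.AcSelmer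
  Summit.BirchSwinnertonDyer.Rank1Residual.X11b.Coinv
open Literature.NumberTheory.GaloisRepresentations.DiscreteGaloisModule (unramifiedSubgroup TateDual SelmerStructure)

variable {K : Type} [Field K] [NumberField K] (W : WeierstrassCurve K) (p : ℕ) [Fact p.Prime]
  (κ : ZpExtension K p) (J : ℕ)

/-! ### §1 `res_{K_v} y' = 0` ⟹ `twistedTorsionToH1 y'` dies on `ker κ ⊓ D_v` -/

/-- **If a class `y'` of `H¹(Γ_K, E[p^J](χ_u))` restricts to zero on `Γ_{K_v}`, its image `twistedTorsionToH1 y'` in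
`H¹(K_∞, E[p^∞])` lies in `awayKer (ker κ) E[p^∞] v`** (dies on `ker κ ⊓ D_v`): the cocycle of `y'` is `τ ↦ τ⋆m − m` on `Γ_{K_v}`,
every element of `D_v` is a `τ|_{K̄}`, and on `ker κ` the twisted action `⋆` is the plain one. [cite: GreenbergLNM1716, §4 p. 124]
[cite: SerreGaloisCohomology1997, I §2.4] -/
theorem twistedTorsionToH1_mem_awayKer_of_res_eq_zero {u : ℤ} (hu : (p : ℤ) ∣ u - 1)
    (y' : galoisCohomology (W.twistedTorsionGaloisModule p κ J u hu) 1) {v : HeightOneSpectrum (𝓞 K)}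
    (h0 : galoisCohomology.res (W.twistedTorsionGaloisModule p κ J u hu) (v.adicCompletion K) 1 y' = 0) :
    W.twistedTorsionToH1 p κ J u hu y' ∈ awayKer κ.kerSubgroup (W.geomPrimaryTorsion p) v := by
  obtain ⟨ξ, rfl⟩ := oneCocycleClass_surjective _ y'
  rw [galoisCohomology.res_one_oneCocycleClass] at h0
  obtain ⟨m, hm⟩ := (oneCocycleClass_eq_zero_iff _ _).mp h0
  -- the cocycle of `y'` is `τ ↦ τ ⋆ m − m` on `Γ_{K_v}`
  have hm' : ∀ τ : absoluteGaloisGroup (v.adicCompletion K), ξ.1 (absGaloisRestrict K (v.adicCompletion K) τ) =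
      W.twistedTorsionGaloisModule p κ J u hu (absGaloisRestrict K (v.adicCompletion K) τ) m - m := fun τ ↦ hm τ
  rw [W.twistedTorsionToH1_oneCocycleClass p κ J u hu, awayKer, AddMonoidHom.mem_ker, resOfLe_oneCocycleClass_eq_zero_iff]
  refine ⟨AddSubgroup.inclusion (Literature.Barriers.BirchSwinnertonDyer.geomTorsion_pow_le_geomPrimaryTorsion W p J) m,
    fun x ↦ ?_⟩
  -- `x ∈ ker κ ⊓ D_v`: `x = τ|_{K̄}` for some `τ ∈ Γ_{K_v}`; the twisted action of `x ∈ ker κ` on `m` is the plain one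
  obtain ⟨hxH, hxD⟩ := Subgroup.mem_inf.mp x.2
  obtain ⟨τ, hτ⟩ := (mem_decomp_iff v (x : absoluteGaloisGroup K)).mp hxD
  have hmτ := hm' τ
  rw [hτ, ZpExtension.galoisTwist_apply_of_mem_kerSubgroup _ _ _ _ _ _ hxH, torsionGaloisModule_apply_apply] at hmτ
  rw [contOneCocycles.push_apply, ZpExtension.pullback_galoisTwistResHom_apply]
  change AddSubgroup.inclusion _ (ξ.1 ((Subgroup.inclusion (inf_le_left : κ.kerSubgroup ⊓ decomp v ≤ κ.kerSubgroup) x :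
      κ.kerSubgroup) : absoluteGaloisGroup K)) = _
  rw [Subgroup.coe_inclusion, hmτ, map_sub]
  rfl

/-! ### §2 The dual class lands in `Sel_𝔭^{S₀}(K_∞, E[p^∞])` -/

section Control

variable [W.IsElliptic] (S₀ : Finset (HeightOneSpectrum (𝓞 K))) {u u' : ℤ}
  (hu : (p : ℤ) ∣ u - 1) (hu' : (p : ℤ) ∣ u' - 1) (huu' : ((p : ℤ) ^ J) ∣ u * u' - 1)
  (e : W.geomTorsion ((p ^ J : ℕ) : ℤ) → W.geomTorsion ((p ^ J : ℕ) : ℤ) → AlgebraicClosure K)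
  (hμ : ∀ S T, e S T ^ (p ^ J) = 1)
  (hadd₁ : ∀ S₁ S₂ T, e (S₁ + S₂) T = e S₁ T * e S₂ T)
  (hadd₂ : ∀ S T₁ T₂, e S (T₁ + T₂) = e S T₁ * e S T₂)
  (hgal : ∀ (σ : absoluteGaloisGroup K) (S T : W.geomTorsion ((p ^ J : ℕ) : ℤ)),
    σ • e S T = e (σ • S) (σ • T))
  (hnondeg : ∀ T, (∀ S, e S T = 1) → T = 0)
  [Finite (W.geomTorsion ((p ^ J : ℕ) : ℤ))] [CharZero K]

include hnondeg

set_option maxHeartbeats 400000 in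
/-- **Dual-side control (Greenberg p. 123–124, Castella's structure).** `K` totally complex; `inv` with `IsPerfect` and
`UnramifiedOrthogonal` at level `p^J`; `M_J = E[p^J](χ_u)` unramified with `p^J ∉ v` outside `S = {∞} ∪ S₀ ∪ {v ∣ p}`; `Q ⊆ S` the
target places and `𝔭 ∣ p` a prime with `𝔭 ∉ Q`; at those `v ∉ S₀`, `v ∤ p` that are totally split in `K_∞` the unramified classes of `H¹(K_∞, E[p^∞])` are locally trivial (`hsplit`). Then for every `y'` with
`H¹(w) y' ∈ H¹_{𝓕_Q^*}(K, M_J^D)`: `twistedTorsionToH1 y' ∈ selmerAc E p κ 𝔭 S₀`. [cite: GreenbergLNM1716, §4 pp. 123–124]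
[cite: GreenbergVatsal2000, §2 pp. 16–17] [cite: Castella2018, Def. 2.2 (arXiv:1704.06608 p. 5)] -/
theorem twistedTorsionToH1_mem_selmerAc_of_mem_dualSelmer_strict [IsTotallyComplex K]
    {inv : LocalInvariants K (p ^ J)} (hperf : inv.IsPerfect) (hUO : inv.UnramifiedOrthogonal)
    (hS : ∀ v : HeightOneSpectrum (𝓞 K), (Sum.inr v : Place K) ∉ twistedDescentPlaces (K := K) p S₀ →
      ((p ^ J : ℕ) : 𝓞 K) ∉ v.asIdeal ∧ GaloisRep.IsUnramifiedAt v (W.twistedTorsionGaloisModule p κ J u hu))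
    (Q : Finset (Place K)) (hQ : Q ⊆ twistedDescentPlaces (K := K) p S₀)
    {𝔭 : HeightOneSpectrum (𝓞 K)} (h𝔭 : ((p : ℕ) : 𝓞 K) ∈ 𝔭.asIdeal) (h𝔭Q : (Sum.inr 𝔭 : Place K) ∉ Q)
    (hsplit : ∀ v : HeightOneSpectrum (𝓞 K), v ∉ S₀ → ((p : ℕ) : 𝓞 K) ∉ v.asIdeal → decomp v ≤ κ.kerSubgroup →
      unramifiedKer κ.kerSubgroup (W.geomPrimaryTorsion p) v ≤ awayKer κ.kerSubgroup (W.geomPrimaryTorsion p) v)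
    (y' : galoisCohomology (W.twistedTorsionGaloisModule p κ J u' hu') 1)
    (hy : galoisCohomology.map (W.twistedWeilDual p κ J hu hu' huu' e hμ hadd₁ hadd₂ hgal) 1 y' ∈
      (inv.dualSelmerStructure (W.twistedTorsionGaloisModule p κ J u hu)
        (fun v ↦ if v ∈ Q then ⊥ else W.twistedRelaxedSelmerStructure p S₀ κ J u hu v)).selmerGroup) :
    W.twistedTorsionToH1 p κ J u' hu' y' ∈ selmerAc W p κ 𝔭 (S₀ : Set (HeightOneSpectrum (𝓞 K))) := by
  set c := W.twistedTorsionToH1 p κ J u' hu' y' with hc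
  -- away at the good places `v ∉ S₀`, `v ∤ p`
  have haway : ∀ v : HeightOneSpectrum (𝓞 K), ((p : ℕ) : 𝓞 K) ∉ v.asIdeal → v ∉ (S₀ : Set (HeightOneSpectrum (𝓞 K))) →
      c ∈ awayKer κ.kerSubgroup (W.geomPrimaryTorsion p) v := by
    intro v hpv hvS
    have hvS' : v ∉ S₀ := fun h ↦ hvS (Finset.mem_coe.mpr h)
    have hout : (Sum.inr v : Place K) ∉ twistedDescentPlaces (K := K) p S₀ :=
      (not_mem_twistedDescentPlaces_iff p S₀ v).2 ⟨hvS', hpv⟩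
    have hur : c ∈ unramifiedKer κ.kerSubgroup (W.geomPrimaryTorsion p) v :=
      MultTransportTwistedDescent.twistedTorsionToH1_mem_unramifiedKer W p κ J u' hu' v y'
        (res_mem_unramifiedSubgroup_of_localization_map_mem W p κ J hu hu' huu' e hμ hadd₁ hadd₂ hgal hnondeg y'
          (localization_mem_dual_unramified_of_mem_dualSelmer_strict W p S₀ κ J u hu hUO Q hQ hy hvS' hpv
            (hS v hout).1 (hS v hout).2))
    by_cases hD : decomp v ≤ κ.kerSubgroup
    · exact hsplit v hvS' hpv hD hur
    · have hI : inertia v ≤ κ.kerSubgroup := fun x hx ↦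
        ZpExtension.inertia_le_kerSubgroup_holds K p κ hpv (adicCompletionPrime_mem_primesAbove K v)
          (by rw [inertia_adicCompletionPrime_eq_map_absInertia]; exact hx)
      exact Summit.BirchSwinnertonDyer.Rank1Residual.Additive.unramKer_le_awayKer (κ := κ) (v := v) (W := W) (p := p)
        hI hD hur
  -- strict at `𝔭`: `𝓕_𝔭 = ⊤`, so the dual class is locally trivial at `𝔭`
  have h𝔭S : (Sum.inr 𝔭 : Place K) ∈ twistedDescentPlaces (K := K) p S₀ :=
    (inr_mem_twistedDescentPlaces_iff p S₀ 𝔭).2 (Or.inr h𝔭)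
  have hstrict : c ∈ awayKer κ.kerSubgroup (W.geomPrimaryTorsion p) 𝔭 :=
    twistedTorsionToH1_mem_awayKer_of_res_eq_zero W p κ J hu' y'
      (res_eq_zero_of_localization_map_eq_zero W p κ J hu hu' huu' e hμ hadd₁ hadd₂ hgal hnondeg y'
        (localization_eq_zero_of_mem_dualSelmer_strict W p S₀ κ J u hu hperf Q hy h𝔭S h𝔭Q))
  -- assemble (all conjugates: `c` is an eigenclass of every `conj_σ`)
  rw [selmerAc, mem_selmerOver_iff_awayKer]
  refine ⟨fun v hpv hvS σ ↦ W.conjH1_twistedTorsionToH1_mem p κ J u' hu' _ y' (haway v hpv hvS) σ,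
    fun w σ ↦ ?_, fun σ ↦ W.conjH1_twistedTorsionToH1_mem p κ J u' hu' _ y' hstrict σ⟩
  exact mem_infKer_of_decompInf_eq_bot w (decompInf_eq_bot_of_isComplex (IsTotallyComplex.isComplex w)) _

/-! ### §3 The uniform exponent -/

/-- **`p^{a+b+b} · y' = 0` for every `y'` whose Weil image is a dual Selmer class of `𝓕_Q`**, when `p^a` kills the `u`-eigenvectors
of `conj_γ` on `Sel_𝔭^{S₀}(K_∞, E[p^∞])` and `p^b` kills `E[p^∞]^{Gal(K̄/K_∞)}` (Greenberg p. 123 «`S'_{T^*}(F)` … in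
`H¹(F_Σ/F, T^*)_tors`»; bound INDEPENDENT of `J`). [cite: GreenbergLNM1716, §4 pp. 123–124] -/
theorem pow_smul_eq_zero_of_mem_dualSelmer_strict [IsTotallyComplex K]
    {inv : LocalInvariants K (p ^ J)} (hperf : inv.IsPerfect) (hUO : inv.UnramifiedOrthogonal)
    (hS : ∀ v : HeightOneSpectrum (𝓞 K), (Sum.inr v : Place K) ∉ twistedDescentPlaces (K := K) p S₀ →
      ((p ^ J : ℕ) : 𝓞 K) ∉ v.asIdeal ∧ GaloisRep.IsUnramifiedAt v (W.twistedTorsionGaloisModule p κ J u hu))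
    (Q : Finset (Place K)) (hQ : Q ⊆ twistedDescentPlaces (K := K) p S₀)
    {𝔭 : HeightOneSpectrum (𝓞 K)} (h𝔭 : ((p : ℕ) : 𝓞 K) ∈ 𝔭.asIdeal) (h𝔭Q : (Sum.inr 𝔭 : Place K) ∉ Q)
    (hsplit : ∀ v : HeightOneSpectrum (𝓞 K), v ∉ S₀ → ((p : ℕ) : 𝓞 K) ∉ v.asIdeal → decomp v ≤ κ.kerSubgroup →
      unramifiedKer κ.kerSubgroup (W.geomPrimaryTorsion p) v ≤ awayKer κ.kerSubgroup (W.geomPrimaryTorsion p) v)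
    {γ : absoluteGaloisGroup K} (hγ : κ.IsTopGenerator γ) {a b : ℕ}
    (ha : ∀ s ∈ selmerAc W p κ 𝔭 (S₀ : Set (HeightOneSpectrum (𝓞 K))), W.conjH1 p κ.kerSubgroup γ s = u • s → p ^ a • s = 0)
    (hb : ∀ P : W.geomPrimaryTorsion p, (∀ h : κ.kerSubgroup, h • P = P) → p ^ b • P = 0)
    (y' : galoisCohomology (W.twistedTorsionGaloisModule p κ J u' hu') 1)
    (hy : galoisCohomology.map (W.twistedWeilDual p κ J hu hu' huu' e hμ hadd₁ hadd₂ hgal) 1 y' ∈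
      (inv.dualSelmerStructure (W.twistedTorsionGaloisModule p κ J u hu)
        (fun v ↦ if v ∈ Q then ⊥ else W.twistedRelaxedSelmerStructure p S₀ κ J u hu v)).selmerGroup) :
    p ^ (a + b + b) • y' = 0 :=
  W.pow_smul_eq_zero_of_twistedTorsionToH1_mem p κ J hu' huu' hγ hb
    (selmerAc W p κ 𝔭 (S₀ : Set (HeightOneSpectrum (𝓞 K)))) ha y'
    (twistedTorsionToH1_mem_selmerAc_of_mem_dualSelmer_strict W p κ J S₀ hu hu' huu' e hμ hadd₁ hadd₂ hgal hnondeg hperf hUO hS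
      Q hQ h𝔭 h𝔭Q hsplit y' hy)

end Control

end Summit.BirchSwinnertonDyer.BirchSwinnertonDyer.Theorems.UniversalToricDescentTwistedDescent

end
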